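import Mathlib.AlgebraicTopology.FundamentalGroupoid.SimplyConnected
import Literature.Probability.LatticeModels.SRWKilledWalkFunctionals
import Literature.Probability.RandomPlanarGeometry.ChordalLERWScalingLimit
import HarnessLib

/-!
# Hitting probabilities of simple random walk in simply connected grid domains against the Poisson
# kernel, uniformly in the domain (Lawler–Schramm–Werner 2004, Prop. 2.2 and Lemma 5.3)

Topic `Literature/Probability/LatticeModels` (discrete potential theory on `ℤ²`; companions
`SRWKilledWalkFunctionals.lean` — the killed Green function `SRW.killedGreen` and the excursion
functional `SRW.exitAfterAvoiding` —, `GreenFunctionConformalRadius.lean` — Kozdron–Lawler's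
Green-function estimate, the analogous uniform statement for the DIAGONAL Green function).

G. F. Lawler, O. Schramm, W. Werner, *Conformal invariance of planar loop-erased random walks and
uniform spanning trees*, Ann. Probab. 32 (2004) 939–995 (arXiv:math/0112234), §2.2 and §5:

> "A grid domain `D` is a domain whose boundary consists of edges of the grid `ℤ²`. For an arbitrary
> domain `D ⊂ ℂ`, and `p ∈ D` define the inner radius `inr_p(D) := inf{|z − p| : z ∉ D}`. Let `𝔇`
> denote the set of all simply connected grid domains such that `0 < inrad(D) < ∞` … Let
> `V(D) := D ∩ ℤ²` … Suppose `v ∈ ℤ² ∩ ∂D`, and `e` is an edge incident with `v` that intersects `D`.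
> The set of such pairs `w = (v, e)` will be denoted `V_∂(D)`. If `ψ : D → 𝕌` is conformal, then
> `ψ(w)` will be shorthand for the limit of `ψ(z)` as `z → v` along `e` (which always exists) …
> if a random walk first exits `D` at `v`, we say that it exited `D` at `w` if the edge `e` was used
> when first hitting `v`. If `a ∈ V(D)` and `b ∈ V(D) ∪ V_∂(D)`, define `H(a, b) = H_D(a, b)` as the
> probability that simple random walk started from `a` and stopped at its first exit time of `D`
> visits `b`. For any `w ∈ D` and `u ∈ V_∂(D)`, we define
> `λ = λ(w, u; D) := (1 − |ψ(w)|²)/|ψ(w) − ψ(u)|²` …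
> **Proposition 2.2 (Hitting probability).** For every `ε > 0` there is some `r₀ > 0` such that the
> following holds. Let `D ∈ 𝔇` satisfy `inrad(D) > r₀`, let `u ∈ V_∂(D)` and `w ∈ V(D)`. Suppose
> `|ψ_D(w)| ≤ 1 − ε` and `H(0, u) ≠ 0`. Then `|H(w, u)/H(0, u) − λ(w, u; D)| < ε`."
> (`ψ_D : D → 𝕌` is "the unique conformal homeomorphism … onto the unit disk … such that `ψ_D(0) = 0`
> and `ψ_D'(0)` is a positive real", §2.1.)
>
> **Lemma 5.3 (Boundary hitting).** "For every `ε₁, ε₂ > 0` there is a `δ = δ(ε₁, ε₂) > 0` such that if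
> `D ∈ 𝔇` and `w ∈ V(D)` is a vertex satisfying `|ψ_D(w)| ≥ 1 − δ`, then the probability that simple
> random walk started at `w` will hit `{v ∈ V(D) : |ψ_D(v) − ψ_D(w)| > ε₁}` before hitting `∂D` is at
> most `ε₂`."

(Numbering of the published version; in the arXiv text these are Proposition 5 and Lemma 33.) These
are the uniform-in-the-domain "discrete harmonic measure → continuous harmonic measure" inputs of the
LERW/UST scaling limits; no smoothness of the boundary is assumed. This file only STATES them as named
facts (`def … : Prop`), in the tree's vocabulary:

* the walk "stopped at its first exit time of `D`" is the walk on the sites `V(D)` run along the edges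
  of `ChordalLERW.siteGraph (latticeVertices D)` and killed at its first step that is not such an edge
  (for a grid domain a nearest-neighbour step out of `V(D)` lands exactly on a vertex of `∂D`, since an
  open grid edge meets the boundary — a union of closed grid edges — only at lattice points);
* for `u = (v, e)` with `e = [q, v]`, `q ∈ V(D)`, the exit probability `H(a, u)` is, by the last-exit
  decomposition (Kozdron–Lawler 2005, §2.9: "`h_A(x, y) = (1/4) Σ_{(z,y) ∈ ∂_e A} G_A(x, z)`"), EXACTLY
  `G_D(a, q)/4` with `G_D = SRW.killedGreen (siteGraph V(D))` (the walk is at `q` at time `n` without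
  having left `V(D)`, and then steps to `v` with probability `1/4`); we take this as the definition
  `exitProb D a q v` (pairs `(v, e)` whose edge has both end-points on `∂D` have `H = 0` and are
  excluded by the hypothesis `H(0, u) ≠ 0` of the proposition anyway);
* the Riemann map is a predicate (`IsDiscMap`, as `KozdronLawler.IsUnitDiscMap`), the boundary value
  `ψ(u)` along the edge is a hypothesis `Tendsto … (𝓝 c)` (the paper asserts its existence), simple
  connectivity is Mathlib's `IsSimplyConnected`, and "hits `B` before `∂D`" is the complement of the
  total excursion mass avoiding `B` (`SRW.exitAfterAvoiding`).

Deliberately NOT here: the proofs (§5.1–5.2 of the paper: discrete derivative estimates, Harnack,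
continuous harmonic approximation by compactness, Koebe distortion), and the consequences for the
harmonic measure of boundary arcs.

## References

* G. F. Lawler, O. Schramm, W. Werner, Ann. Probab. 32 (2004) 939–995, arXiv:math/0112234, §2.1,
  §2.2 (Prop. 2.2), §5.1 (Lemma 5.3) [LawlerSchrammWerner2004].
* M. J. Kozdron, G. F. Lawler, Electron. J. Probab. 10 (2005) 1442–1467, §2.9 [KozdronLawler2005].
-/

noncomputable section

open Set Metric Filter Topology
open Literature.Probability.RandomPlanarGeometry (ChordalLERW.siteGraph)

namespace Literature.Probability.LatticeModels

namespace LSWGrid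

/-- A **grid domain**: a domain (open connected set) of `ℂ` whose boundary consists of closed edges of
the grid `ℤ²` (is the union of a set of unit segments between nearest-neighbour lattice points), §2.2.
[cite: LawlerSchrammWerner2004, §2.2] -/
def IsGridDomain (D : Set ℂ) : Prop :=
  IsOpen D ∧ IsConnected D ∧ ∃ E : Set (Site 2 × Site 2), (∀ e ∈ E, (zdGraph 2).Adj e.1 e.2) ∧
    frontier D = ⋃ e ∈ E, segment ℝ (Site.toComplex e.1) (Site.toComplex e.2)

/-- **The class `𝔇`**: simply connected grid domains with `0 < inrad(D) < ∞`, i.e. containing the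
origin and different from `ℂ`, §2.2. [cite: LawlerSchrammWerner2004, §2.2] -/
def IsClassD (D : Set ℂ) : Prop :=
  IsGridDomain D ∧ IsSimplyConnected D ∧ (0 : ℂ) ∈ D ∧ D ≠ univ

/-- `V(D) = D ∩ ℤ²`, the lattice points in `D`, §2.2. [cite: LawlerSchrammWerner2004, §2.2] -/
def latticeVertices (D : Set ℂ) : Set (Site 2) :=
  {x | Site.toComplex x ∈ D}

/-- `ψ_D`: **a conformal homeomorphism of `D` onto the unit disc with `ψ_D(0) = 0`, `ψ_D'(0) > 0`**
(§2.1), as a predicate (holomorphic on `D`, a bijection of `D` onto `𝕌`, normalised at `0`).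
[cite: LawlerSchrammWerner2004, §2.1] -/
def IsDiscMap (D : Set ℂ) (ψ : ℂ → ℂ) : Prop :=
  DifferentiableOn ℂ ψ D ∧ BijOn ψ D (ball 0 1) ∧ ψ 0 = 0 ∧ 0 < (deriv ψ 0).re ∧ (deriv ψ 0).im = 0

open Classical in
/-- **`H(a, u)` for `u = (v, e)`, `e = [q, v]`**: the probability that simple random walk from `a`,
stopped at its first exit from `D`, exits at the boundary vertex `v` USING the edge from `q` (§2.2),
written through the last-exit decomposition as `G_D(a, q)/4`, `G_D` the Green function of the walk on
`V(D)` killed at its first step out of `V(D)` (Kozdron–Lawler 2005, §2.9,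
"`h_A(x,y) = (1/4) Σ_{(z,y) ∈ ∂_e A} G_A(x,z)`", one term of the sum). [cite: KozdronLawler2005, §2.9] -/
def exitProb (D : Set ℂ) (a q v : Site 2) : ℝ :=
  if (zdGraph 2).Adj q v ∧ q ∈ latticeVertices D ∧ v ∉ latticeVertices D then
    SRW.killedGreen (ChordalLERW.siteGraph (latticeVertices D)) a q / 4
  else 0

/-- `λ(w, u; D) = (1 − |ψ(w)|²)/|ψ(w) − ψ(u)|²`, "the continuous analog of `H(w,u)/H(0,u)`" (the
Poisson kernel of `𝕌` at `ψ(w)` for the boundary point `ψ(u)`, normalised at the centre), §2.2; here as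
a function of `z = ψ(w)` and `c = ψ(u)`. [cite: LawlerSchrammWerner2004, §2.2] -/
def poissonRatio (z c : ℂ) : ℝ :=
  (1 - ‖z‖ ^ 2) / ‖z - c‖ ^ 2

/-- **The probability that the walk from `w` hits the set `B ⊆ V(D)` before hitting `∂D`**: one minus
the total mass of the excursions from `w` that are killed (step out of `V(D)`) before any visit to `B`
(`SRW.exitAfterAvoiding` summed over the last vertex before killing). [cite: LawlerSchrammWerner2004, §5.1 Lemma 5.3] -/
def hitBeforeExitProb (D : Set ℂ) (w : Site 2) (B : Set (Site 2)) : ℝ :=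
  1 - ∑' q : Site 2, SRW.exitAfterAvoiding (ChordalLERW.siteGraph (latticeVertices D)) w q B

end LSWGrid

open LSWGrid

/-- **Lawler–Schramm–Werner 2004, Proposition 2.2 (Hitting probability)** (named fact, unproved here):
for every `ε > 0` there is `r₀ > 0` such that for every `D ∈ 𝔇` with `inrad(D) > r₀`, every Riemann map
`ψ` of `D` normalised at `0`, every boundary pair `u = (v, [q, v])` (`q ∈ V(D)` a nearest neighbour of
the boundary vertex `v ∉ D`) with boundary value `ψ(u) = c` along the edge, and every `w ∈ V(D)` with
`|ψ(w)| ≤ 1 − ε` and `H(0, u) ≠ 0`: `|H(w, u)/H(0, u) − (1 − |ψ(w)|²)/|ψ(w) − ψ(u)|²| < ε`.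
"For every `ε > 0` there is some `r₀ > 0` such that the following holds. Let `D ∈ 𝔇` satisfy
`inrad(D) > r₀`, let `u ∈ V_∂(D)` and `w ∈ V(D)`. Suppose `|ψ_D(w)| ≤ 1 − ε` and `H(0,u) ≠ 0`. Then
`|H(w,u)/H(0,u) − λ(w,u;D)| < ε`." [cite: LawlerSchrammWerner2004, §2.2 Prop. 2.2] -/
def hittingProbability_ratio_poissonKernel : Prop :=
  ∀ ε : ℝ, 0 < ε → ∃ r₀ : ℝ, 0 < r₀ ∧ ∀ D : Set ℂ, IsClassD D → r₀ < infDist (0 : ℂ) Dᶜ →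
    ∀ ψ : ℂ → ℂ, IsDiscMap D ψ →
    ∀ q v w : Site 2, (zdGraph 2).Adj q v → q ∈ latticeVertices D → v ∉ latticeVertices D →
      w ∈ latticeVertices D →
    ∀ c : ℂ, Tendsto (fun t : ℝ => ψ (Site.toComplex q + t * (Site.toComplex v - Site.toComplex q)))
        (𝓝[<] (1 : ℝ)) (𝓝 c) →
      ‖ψ (Site.toComplex w)‖ ≤ 1 - ε → exitProb D 0 q v ≠ 0 →
      |exitProb D w q v / exitProb D 0 q v - poissonRatio (ψ (Site.toComplex w)) c| < ε

/-- **Lawler–Schramm–Werner 2004, Lemma 5.3 (Boundary hitting)** (named fact, unproved here): "For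
every `ε₁, ε₂ > 0` there is a `δ = δ(ε₁, ε₂) > 0` such that if `D ∈ 𝔇` and `w ∈ V(D)` is a vertex
satisfying `|ψ_D(w)| ≥ 1 − δ`, then the probability that simple random walk started at `w` will hit
`{v ∈ V(D) : |ψ_D(v) − ψ_D(w)| > ε₁}` before hitting `∂D` is at most `ε₂`."
[cite: LawlerSchrammWerner2004, §5.1 Lemma 5.3] -/
def boundaryHitting : Prop :=
  ∀ ε₁ ε₂ : ℝ, 0 < ε₁ → 0 < ε₂ → ∃ δ : ℝ, 0 < δ ∧ ∀ D : Set ℂ, IsClassD D →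
    ∀ ψ : ℂ → ℂ, IsDiscMap D ψ → ∀ w : Site 2, w ∈ latticeVertices D →
      1 - δ ≤ ‖ψ (Site.toComplex w)‖ →
      hitBeforeExitProb D w
          {v | v ∈ latticeVertices D ∧ ε₁ < ‖ψ (Site.toComplex v) - ψ (Site.toComplex w)‖} ≤ ε₂

/-! ### Sanity of the vocabulary -/

/-- The exit probability through a pair that is not a boundary dart of `D` is `0` (junk convention).
[folklore] -/
theorem LSWGrid.exitProb_of_not {D : Set ℂ} {a q v : Site 2}
    (h : ¬ ((zdGraph 2).Adj q v ∧ q ∈ latticeVertices D ∧ v ∉ latticeVertices D)) :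
    exitProb D a q v = 0 := by
  rw [exitProb, if_neg h]

/-- The exit probability is nonnegative. [folklore] -/
theorem LSWGrid.exitProb_nonneg (D : Set ℂ) (a q v : Site 2) : 0 ≤ exitProb D a q v := by
  unfold exitProb
  split_ifs
  · exact div_nonneg (SRW.killedGreen_nonneg _ _ _) (by norm_num)
  · exact le_rfl

end Literature.Probability.LatticeModels

end
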